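import Summits.RiemannHypothesis.RiemannHypothesis.Theorems.UniversalFactorMediumCover
import Summits.RiemannHypothesis.RiemannHypothesis.Theorems.UniversalFactorMediumLowDefs
import Summits.RiemannHypothesis.RiemannHypothesis.Theorems.UniversalFactorMediumKernelNoGoStubH0cosh

/-!
# RiemannHypothesis / UniversalFactor — low window A of `MediumKernelNoGo` (certified computation)

Route `RiemannHypothesis/UniversalFactor`, crux `MediumKernelNoGo` (stmt-RiemannHypothesis-2577), line
`one-sided-average-sign-test`.  ONE `native_decide` evaluation of the certified checker
(`UniversalFactorMediumDefs/BoxDefs/LowDefs.lean`, soundness `UniversalFactorMediumCover.lean`):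
at the point `x = 64.6` (hump: `H_0(x) > 0`), with `20 + 20` Gauss–Legendre y-cells of width 4, the
backward and forward one-sided Laplace(`a`) averages of `H_0` are negative for every `a` of each of the
4 boxes covering `[0.392698, 0.445757]` — interval weights `[e^{−a₂y}, e^{−a₁y}]` carry the continuum of `a`.
It also proves the soundness wrapper `osaWindowCheck_sound` shared by the three windows.
-/

set_option linter.dupNamespace false

noncomputable section

namespace Summit.RiemannHypothesis.RiemannHypothesis.Theorems

open MeasureTheory Set
open Literature.NumberTheory.LFunctions
open Literature.Analysis.ValidatedNumerics Literature.Analysis.ValidatedNumerics.NumericsMP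

/-- A passing parametrised window check exposes its context. [folklore] -/
theorem UniversalFactor.osaWindowCheckWith_some {oc : Option UniversalFactor.OsaCtx} {pt : UniversalFactor.OsaPoint}
    {As : List ℕ} (h : UniversalFactor.osaWindowCheckWith oc pt As = true) :
    ∃ C, oc = some C ∧
      UniversalFactor.osaCoverCheck C [pt] As (List.replicate (As.length - 1) 0) UniversalFactor.osaAD = true := by
  cases oc with
  | none => exact absurd h Bool.false_ne_true
  | some C => exact ⟨C, rfl, h⟩

/-- **Soundness of a single-point window check**: the data context is valid (`valid_of_mkOsaCtx`), the
strip bound is `stub_H0cosh`, and `osaCoverCheck_sound` applies. [folklore] -/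
theorem UniversalFactor.osaWindowCheck_sound {pt : UniversalFactor.OsaPoint} {As : List ℕ}
    (h : UniversalFactor.osaWindowCheck pt As = true) (hlen : 2 ≤ As.length) (a : ℝ)
    (h1 : (As.getD 0 0 : ℝ) / UniversalFactor.osaAD ≤ a) (h2 : a ≤ (As.getD (As.length - 1) 0 : ℝ) / UniversalFactor.osaAD) :
    ∃ x : ℝ, 0 ≤ x ∧
      (((deBruijnH 0 x).re < 0 ∧
          0 < (∫ y in Ioi (0:ℝ), deBruijnH 0 ((x : ℂ) - y) * (Real.exp (-(a * y)) : ℂ)).re ∧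
          0 < (∫ y in Ioi (0:ℝ), deBruijnH 0 ((x : ℂ) + y) * (Real.exp (-(a * y)) : ℂ)).re) ∨
        (0 < (deBruijnH 0 x).re ∧
          (∫ y in Ioi (0:ℝ), deBruijnH 0 ((x : ℂ) - y) * (Real.exp (-(a * y)) : ℂ)).re < 0 ∧
          (∫ y in Ioi (0:ℝ), deBruijnH 0 ((x : ℂ) + y) * (Real.exp (-(a * y)) : ℂ)).re < 0)) :=
  have hsome : ∃ C, UniversalFactor.mkOsaCtx 256 90 64 20 3 400 1 10 64 6 = some C ∧
      UniversalFactor.osaCoverCheck C [pt] As (List.replicate (As.length - 1) 0) UniversalFactor.osaAD = true :=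
    UniversalFactor.osaWindowCheckWith_some h
  hsome.elim fun _ hC =>
    UniversalFactor.osaCoverCheck_sound UniversalFactor.stub_H0cosh
      (UniversalFactor.valid_of_mkOsaCtx hC.1 (by norm_num) (by norm_num) (by norm_num) (by norm_num) (by norm_num)
        (by norm_num) (by norm_num)) hlen hC.2 h1 h2

/-- **The certified computation of window A** (`native_decide`; the only computational step). [folklore] -/
theorem UniversalFactor.osaWindowA_check :
    UniversalFactor.osaWindowCheck UniversalFactor.osaPtA UniversalFactor.osaAsA = true := by
  native_decide

/-- **Registered sub-goal `stub_lowWindowA` — low window A**: every `a ∈ [392698·10⁻⁶, 445757·10⁻⁶]` has a point `x ≥ 0` (namely `x = 64.6`) with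
a filled dip or hump of the one-sided Laplace(`a`) averages of `H_0`. [folklore] -/
theorem UniversalFactor.stub_lowWindowA : ∀ a : ℝ, (392698 : ℝ) / 1000000 ≤ a → a ≤ (445757 : ℝ) / 1000000 →
    ∃ x : ℝ, 0 ≤ x ∧
      (((deBruijnH 0 x).re < 0 ∧
          0 < (∫ y in Ioi (0:ℝ), deBruijnH 0 ((x : ℂ) - y) * (Real.exp (-(a * y)) : ℂ)).re ∧
          0 < (∫ y in Ioi (0:ℝ), deBruijnH 0 ((x : ℂ) + y) * (Real.exp (-(a * y)) : ℂ)).re) ∨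
        (0 < (deBruijnH 0 x).re ∧
          (∫ y in Ioi (0:ℝ), deBruijnH 0 ((x : ℂ) - y) * (Real.exp (-(a * y)) : ℂ)).re < 0 ∧
          (∫ y in Ioi (0:ℝ), deBruijnH 0 ((x : ℂ) + y) * (Real.exp (-(a * y)) : ℂ)).re < 0)) :=
  fun a h1 h2 => UniversalFactor.osaWindowCheck_sound UniversalFactor.osaWindowA_check (by simp [UniversalFactor.osaAsA]) a
    (by simpa [UniversalFactor.osaAsA, UniversalFactor.osaAD] using h1)
    (by simpa [UniversalFactor.osaAsA, UniversalFactor.osaAD] using h2)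

end Summit.RiemannHypothesis.RiemannHypothesis.Theorems
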